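import Summits.Ventures.CertifiedManyBodySolver.Observables.StiffnessThermalCouplingDilution
import HarnessLib

/-!
# ROUTE T-A‴ off the `t′ = 0` axis: the TWO-FLOOR `(U₁, t′₁)`-CHORD — a thermal kinetic ceiling, hence `T_KT ≤ 1/β`, at `t′ ≠ 0`
# from TWO ground-state energy floors whose `t′`-anchors AVERAGE to `2t′` and ONE thermal double-occupancy cap

HONEST FRAMING: a one-sided CEILING chain (energy coordinates ⇒ kinetic energy ⇒ stiffness ⇒ `T_KT`); not a superconductivity verdict,
not a `T_c` of any material, no number here. Cell `pub/hubbard-tc` (MO-S3 ORDER → `T_c` back-end), seat `hubbard-tc-mod-2` (KT back-end),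
continuation of `Observables/StiffnessThermalCouplingDilution.lean` (p487951/p489048; that file is at the 400-line cap, hence a new module).

THE OBSERVATION. For a torus limit `ω` of the canonical `(rectN n L, S^z = 0)` Gibbs states of `hubbardTorusTT' L 1 t′ U` at `β`, the
`x₁`-f-sum bond word is `Re ω(k₀^{tt′}) = −½(K₁(ω) + 2t′K₂(ω))` (`re_expect_kinBondObsTT_eq_of_isD4Invariant`), so a dilution floor is
wanted at the `t′`-coordinate `2t′`, where typically NO certified ground-state floor exists. But the mean energy
`⟨K₁ + τK₂ + υD⟩_ω` is AFFINE in the anchor `(υ, τ)` and dominates `e(1,τ,υ,n)` at EVERY anchor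
(`IsTorusLimitOfMixture.energyDensityTT'_le_meanEnergy_add_slopes`, Ruelle's variational principle rewritten with the affine coupling
dependence), hence for convex weights `λ_a + λ_b = 1` with `λ_aτ_a + λ_bτ_b = 2t′` and two certified floors
`e_a ≤ e(1,τ_a,U_a,n)`, `e_b ≤ e(1,τ_b,U_b,n)`:
  `λ_a e_a + λ_b e_b ≤ K₁ + 2t′K₂ + (λ_aU_a + λ_bU_b)·D(ω)`,
EXACTLY at the word's `t′`-coordinate, with NO `⟨K₂⟩` cap. With a thermal docc cap `D(ω) ≤ d^{up}` (e.g. the free-entropy chord of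
`HubbardTTPrimeFreeGCPressure` §4): `Re ω(k₀^{tt′}) ≤ ½((λ_aU_a + λ_bU_b)·d^{up} − (λ_a e_a + λ_b e_b))`, the single-temperature leaf, and
`T_KT ≤ 1/β` as soon as `(π/16)((λ_aU_a + λ_bU_b)·d^{up} − (λ_a e_a + λ_b e_b)) < 1/β` (monotonicity-free: K1t K1b K2 only).
SIZING (2026-08-29): at the cuprate point `(8, ⅞, −¼)` the floors CERTIFIED #554 `(7/2, ⅞, −11/20)` and #555 `(7/2, ⅞, −2/5)` with
`(λ_a, λ_b) = (2/3, 1/3)` land at `2t′ = −½`; consumer: `Certificates/HubbardSquare_n7o8_tpm1o4_TKT_tpChord_r554_r555_kernelQuad_r445_b33o10.lean`.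

No new definition, no named fact, no certificate, no numeral: everything is PROVED from landed interfaces.
WHAT THIS IS NOT: no certificate, no number, no `T_c`; pure glue; not a claim that the Hubbard model has a Kosterlitz–Thouless transition.

References: HazraVermaRanderia2019 eqs. (2)–(4); Ruelle1969 §3.4; BratteliRobinsonI1987 §4.3.1; NelsonKosterlitz1977 eq. (1).
-/

noncomputable section

namespace Summit.Ventures.CertifiedManyBodySolver.Observables

open Filter Topology Matrix Finset
open Literature.MathematicalPhysics.QuantumLattice
open Literature.MathematicalPhysics.QuantumLattice.InfVolFermionState
open Literature.MathematicalPhysics.QuantumLattice.ThermodynamicLimit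
open Literature.MathematicalPhysics.QuantumFieldTheory
open Literature.MathematicalPhysics.StatisticalMechanics
open Literature.MathematicalPhysics.StatisticalMechanics.KosterlitzThouless
open Literature.Probability.LatticeModels
open scoped ComplexConjugate ComplexOrder

/-! ### §1 The two-floor `(U₁, t′₁)`-CHORD: off the `t′ = 0` axis WITHOUT a `K₂` cap

At `t′ ≠ 0` the `x₁`-f-sum word is `−½(K₁ + 2t′K₂)` (`re_expect_kinBondObsTT_eq_of_isD4Invariant`), so a single floor at `(U₁, t′)` leaves the term
`−t′K₂` to a separate cap `B` (`StiffnessThermalCouplingDilution` §2, §5). But the thermal mean energy `⟨K₁ + τK₂ + υD⟩_ω` is AFFINE in the anchor `(υ, τ)` and dominates `e(1,τ,υ,n)` at EVERY anchor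
(`IsTorusLimitOfMixture.energyDensityTT'_le_meanEnergy_add_slopes`). Hence TWO certified ground-state floors `e_a ≤ e(1,τ_a,U_a,n)`,
`e_b ≤ e(1,τ_b,U_b,n)` and convex weights `λ_a + λ_b = 1` with `λ_aτ_a + λ_bτ_b = 2t′` give the floor
`λ_a e_a + λ_b e_b ≤ K₁ + 2t′K₂ + (λ_aU_a + λ_bU_b)·D` EXACTLY at the stiffness word's `t′`-coordinate `2t′` — no `K₂` cap, no floor
certified at `2t′` needed. With a thermal docc cap `D(ω) ≤ d^{up}`: `Re ω(k₀^{tt′}) ≤ ½((λ_aU_a + λ_bU_b)·d^{up} − (λ_a e_a + λ_b e_b))`.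
Sizing (cell `pub/hubbard-tc`, seat hubbard-tc-mod-2 g19, 2026-08-29): at the cuprate point `(8, ⅞, −¼)` the floors CERTIFIED #554 `(7/2, ⅞, −11/20)` and
#555 `(7/2, ⅞, −2/5)` with `(λ_a, λ_b) = (2/3, 1/3)` land at `2t′ = −½`; the consumer is a `Certificates/` row file. No number here. -/

/-- **Two-floor chord, state by state.** `0 ≤ n < 2`; weights `λ_a, λ_b ≥ 0`, `λ_a + λ_b = 1`, `λ_aτ_a + λ_bτ_b = 2t′`; anchors
`U_a, U_b ≥ 0` with floors `e_a ≤ e(1,τ_a,U_a,n)`, `e_b ≤ e(1,τ_b,U_b,n)`. For a torus limit `ω` of the canonical sector Gibbs states of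
`hubbardTorusTT' L 1 t′ U` at `β` with `D(ω) ≤ d^{up}`:
`Re ω(k₀^{tt′}) ≤ ½((λ_aU_a + λ_bU_b)·d^{up} − (λ_a e_a + λ_b e_b))`. [cite: Ruelle1969, §3.4] [cite: HazraVermaRanderia2019, eq. (4)] -/
theorem re_expect_kinBondObsTT_le_of_doccCap_of_twoFloors {tp U n β : ℝ} (hn0 : 0 ≤ n) (hn2 : n < 2)
    {la lb Ua Ub ta tb ea eb dup : ℝ} (hla : 0 ≤ la) (hlb : 0 ≤ lb) (hsum : la + lb = 1)
    (ht : la * ta + lb * tb = 2 * tp) (hUa : 0 ≤ Ua) (hUb : 0 ≤ Ub)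
    (hfa : ea ≤ energyDensityTT' 1 ta Ua n) (hfb : eb ≤ energyDensityTT' 1 tb Ub n)
    {ω : InfVolFermionState 2} {Ls : ℕ → ℕ}
    (h : ω.IsTorusLimitOfMixture (sectorGibbsCount n) (fun L => sectorGibbsWeightTT' β 1 tp U n L)
      (fun L => sectorGibbsVectorTT' 1 tp U n L) Ls) (hLs : Tendsto Ls atTop atTop)
    (hdocc : ω.meanEnergy (hubbardTTPrimeFermionInteraction 0 0 1) 1 ≤ dup) :
    (ω.expect (box 2 1) (kinBondObsTT tp)).re ≤ ((la * Ua + lb * Ub) * dup - (la * ea + lb * eb)) / 2 := by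
  have hva := h.energyDensityTT'_le_meanEnergy_add_slopes 1 tp U hn0 hn2 hLs
    (fun L i => sectorGibbsWeightTT'_nonneg β 1 tp U n L i)
    (fun L => sum_sectorGibbsWeightTT' β 1 tp U hn0 hn2.le L)
    (fun L i => isNParticle_sectorGibbsVectorTT' 1 tp U n L i)
    (fun L i => star_sectorGibbsVectorTT'_dotProduct_self 1 tp U n L i) ta hUa
  have hvb := h.energyDensityTT'_le_meanEnergy_add_slopes 1 tp U hn0 hn2 hLs
    (fun L i => sectorGibbsWeightTT'_nonneg β 1 tp U n L i)
    (fun L => sum_sectorGibbsWeightTT' β 1 tp U hn0 hn2.le L)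
    (fun L i => isNParticle_sectorGibbsVectorTT' 1 tp U n L i)
    (fun L i => star_sectorGibbsVectorTT'_dotProduct_self 1 tp U n L i) tb hUb
  rw [← h.meanEnergy_onSite_eq_re_expect_docc hLs] at hva hvb
  have hco := InfVolFermionState.meanEnergy_hubbardTTPrime_eq_coords ω 1 tp U
  rw [re_expect_kinBondObsTT_eq_of_isD4Invariant h.isTranslationInvariant
    (h.isD4Invariant_of_sectorGibbs 1 tp U n β hLs) tp]
  set E := ω.meanEnergy (hubbardTTPrimeFermionInteraction 1 tp U) 1 with hE
  set K₁ := ω.meanEnergy (hubbardTTPrimeFermionInteraction 1 0 0) 1 with hK₁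
  set K₂ := ω.meanEnergy (hubbardTTPrimeFermionInteraction 0 1 0) 1 with hK₂
  set D := ω.meanEnergy (hubbardTTPrimeFermionInteraction 0 0 1) 1 with hD
  -- the chord: `λ_a e_a + λ_b e_b ≤ K₁ + 2t′K₂ + (λ_aU_a + λ_bU_b)·D`
  have key : la * ea + lb * eb ≤ K₁ + 2 * tp * K₂ + (la * Ua + lb * Ub) * D := by
    calc la * ea + lb * eb
        ≤ la * (E + (Ua - U) * D + (ta - tp) * K₂) + lb * (E + (Ub - U) * D + (tb - tp) * K₂) :=
          add_le_add (mul_le_mul_of_nonneg_left (hfa.trans hva) hla) (mul_le_mul_of_nonneg_left (hfb.trans hvb) hlb)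
      _ = (la + lb) * E + ((la * Ua + lb * Ub) - (la + lb) * U) * D + ((la * ta + lb * tb) - (la + lb) * tp) * K₂ := by ring
      _ = E + ((la * Ua + lb * Ub) - U) * D + (2 * tp - tp) * K₂ := by rw [hsum, ht]; ring
      _ = K₁ + 2 * tp * K₂ + (la * Ua + lb * Ub) * D := by rw [hco]; ring
  have hUd : (la * Ua + lb * Ub) * D ≤ (la * Ua + lb * Ub) * dup := mul_le_mul_of_nonneg_left hdocc (by positivity)
  linarith

/-- **Two-floor chord ⇒ the single-temperature leaf.** Weights and anchors as above; for every thermal torus limit at `(β, U)` a docc cap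
`D(ω) ≤ d^{up}`; `c ≥ ((λ_aU_a + λ_bU_b)·d^{up} − (λ_a e_a + λ_b e_b))/4`. Then `ObsThermalStiffnessSeqCeilingAtBeta t′ U n β c`.
[cite: HazraVermaRanderia2019, eqs. (2)–(4)] [cite: Ruelle1969, §3.4] -/
theorem ObsThermalStiffnessSeqCeilingAtBeta_of_doccCap_of_twoFloors {tp U n β : ℝ} (hβ : 0 < β)
    (hn0 : 0 ≤ n) (hn2 : n < 2) {la lb Ua Ub ta tb ea eb dup : ℝ} (hla : 0 ≤ la) (hlb : 0 ≤ lb) (hsum : la + lb = 1)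
    (ht : la * ta + lb * tb = 2 * tp) (hUa : 0 ≤ Ua) (hUb : 0 ≤ Ub)
    (hfa : ea ≤ energyDensityTT' 1 ta Ua n) (hfb : eb ≤ energyDensityTT' 1 tb Ub n)
    (hdocc : ∀ (ω : InfVolFermionState 2) (Ls : ℕ → ℕ), Tendsto Ls atTop atTop →
      ω.IsTorusLimitOfMixture (sectorGibbsCount n) (fun L => sectorGibbsWeightTT' β 1 tp U n L)
        (fun L => sectorGibbsVectorTT' 1 tp U n L) Ls →
      ω.meanEnergy (hubbardTTPrimeFermionInteraction 0 0 1) 1 ≤ dup)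
    {c : ℚ} (hc : ((la * Ua + lb * Ub) * dup - (la * ea + lb * eb)) / 4 ≤ ((c : ℚ) : ℝ)) :
    ObsThermalStiffnessSeqCeilingAtBeta tp U n β c :=
  ObsThermalStiffnessSeqCeilingAtBeta_of_torusLimit_kinetic_le hβ hn0 hn2.le fun ω Ls hLs hω => by
    have h := re_expect_kinBondObsTT_le_of_doccCap_of_twoFloors hn0 hn2 hla hlb hsum ht hUa hUb hfa hfb hω hLs
      (hdocc ω Ls hLs hω)
    linarith

namespace ThermalKTDictionaryAt

variable {tp U n : ℝ} {ρe : ℝ → ℝ} {Tc : ℝ}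

/-- **Two-floor chord ⇒ `Tc ≤ 1/β`.** Weights `λ_a + λ_b = 1` (both `≥ 0`) with `λ_aτ_a + λ_bτ_b = 2t′`; certified ground-state floors
`e_a ≤ e(1,τ_a,U_a,n)`, `e_b ≤ e(1,τ_b,U_b,n)` (`U_a, U_b ≥ 0`); a thermal docc cap `D(ω) ≤ d^{up}` at `(β, U)`; and
`(π/16)·((λ_aU_a + λ_bU_b)·d^{up} − (λ_a e_a + λ_b e_b)) < 1/β`. Monotonicity-free (K1t K1b K2 only).
[cite: HazraVermaRanderia2019, eqs. (2)–(4)] [cite: NelsonKosterlitz1977, eq. (1)] -/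
theorem le_inv_of_doccCap_of_twoFloors (hT : ThermalKTDictionaryAt tp U n ρe Tc) {β : ℝ} (hβ : 0 < β)
    (hn0 : 0 ≤ n) (hn2 : n < 2) {la lb Ua Ub ta tb ea eb dup : ℝ} (hla : 0 ≤ la) (hlb : 0 ≤ lb) (hsum : la + lb = 1)
    (ht : la * ta + lb * tb = 2 * tp) (hUa : 0 ≤ Ua) (hUb : 0 ≤ Ub)
    (hfa : ea ≤ energyDensityTT' 1 ta Ua n) (hfb : eb ≤ energyDensityTT' 1 tb Ub n)
    (hdocc : ∀ (ω : InfVolFermionState 2) (Ls : ℕ → ℕ), Tendsto Ls atTop atTop →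
      ω.IsTorusLimitOfMixture (sectorGibbsCount n) (fun L => sectorGibbsWeightTT' β 1 tp U n L)
        (fun L => sectorGibbsVectorTT' 1 tp U n L) Ls →
      ω.meanEnergy (hubbardTTPrimeFermionInteraction 0 0 1) 1 ≤ dup)
    (hlt : Real.pi / 16 * ((la * Ua + lb * Ub) * dup - (la * ea + lb * eb)) < 1 / β) : Tc ≤ 1 / β := by
  have hπ : 0 < Real.pi / 4 := by positivity
  have hκ : ((la * Ua + lb * Ub) * dup - (la * ea + lb * eb)) / 4 < (1 / β) / (Real.pi / 4) := by
    rw [lt_div_iff₀ hπ]; linarith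
  obtain ⟨c, hc1, hc2⟩ := exists_rat_btwn hκ
  refine hT.le_inv_of_leafAtBeta hβ
    (ObsThermalStiffnessSeqCeilingAtBeta_of_doccCap_of_twoFloors hβ hn0 hn2 hla hlb hsum ht hUa hUb hfa hfb hdocc hc1.le) ?_
  have hc3 := (lt_div_iff₀ hπ).1 hc2
  linarith

/-- **Two-floor chord, docc cap in WORD shape** (`Re ω_{{0}}(n_{0↑}n_{0↓}) ≤ d^{up}`, the reader shape of the free-entropy-chord caps of
`HubbardTTPrimeFreeGCPressure` §4 / `IsTorusLimitOfMixture.re_expect_docc_le_of_freeGCPressureTT'_le_of_upper`) ⇒ `Tc ≤ 1/β`.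
[cite: HazraVermaRanderia2019, eqs. (2)–(4)] [cite: NelsonKosterlitz1977, eq. (1)] -/
theorem le_inv_of_doccWordCap_of_twoFloors (hT : ThermalKTDictionaryAt tp U n ρe Tc) {β : ℝ} (hβ : 0 < β)
    (hn0 : 0 ≤ n) (hn2 : n < 2) {la lb Ua Ub ta tb ea eb dup : ℝ} (hla : 0 ≤ la) (hlb : 0 ≤ lb) (hsum : la + lb = 1)
    (ht : la * ta + lb * tb = 2 * tp) (hUa : 0 ≤ Ua) (hUb : 0 ≤ Ub)
    (hfa : ea ≤ energyDensityTT' 1 ta Ua n) (hfb : eb ≤ energyDensityTT' 1 tb Ub n)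
    (hdocc : ∀ (ω : InfVolFermionState 2) (Ls : ℕ → ℕ), Tendsto Ls atTop atTop →
      ω.IsTorusLimitOfMixture (sectorGibbsCount n) (fun L => sectorGibbsWeightTT' β 1 tp U n L)
        (fun L => sectorGibbsVectorTT' 1 tp U n L) Ls →
      (ω.expect ({0} : Finset (Site 2))
        (nAt 0 (Finset.mem_singleton_self 0) 0 * nAt 0 (Finset.mem_singleton_self 0) 1)).re ≤ dup)
    (hlt : Real.pi / 16 * ((la * Ua + lb * Ub) * dup - (la * ea + lb * eb)) < 1 / β) : Tc ≤ 1 / β :=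
  hT.le_inv_of_doccCap_of_twoFloors hβ hn0 hn2 hla hlb hsum ht hUa hUb hfa hfb
    (fun ω Ls hLs hω => by rw [hω.meanEnergy_onSite_eq_re_expect_docc hLs]; exact hdocc ω Ls hLs hω) hlt

end ThermalKTDictionaryAt

end Summit.Ventures.CertifiedManyBodySolver.Observables

end
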